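import Summits.QuantumFields.BalabanUV.InfraRed.StrongCouplingForestHolonomyGauge
import Summits.QuantumFields.BalabanUV.InfraRed.StrongCouplingFrozenForestClustering
import Summits.QuantumFields.BalabanUV.InfraRed.StrongCouplingFluxCovariance
import HarnessLib

/-!
# Strong-coupling front, J-SC19: THE FOREST DOBRUSHIN DOOR IS A THEOREM (rungs F2 + F3 by name); the `SU(2)` front
SC-b on the CLOSED window `0 ≤ β_W ≤ 2/9` through it, and below `4/15` given ONLY rung F4 —
observatory of the non-perturbative crossover; no mass-gap claim

IR-3 v2 TWO-FRONT CROSSOVER LEDGER, front SC (`β₀`), SU(2), `d = 4`, Wilson normalisation `β_W = 4/g²`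
(tree bare coupling `β_t = β_W/2`, 't Hooft `β_W/4`).
ABSOLUTE RULE of this package: No internally-minted statement may enter as a cited fact. Every hypothesis is either
kernel-proved in this package or a verbatim quotation of a PUBLISHED theorem with page reference. The manuscript(s)
under audit are NOT citable for their own disputed steps — they are the thing under adjudication; programme-internal
(2001/route/tribunal) claims are never citable.

WHAT THIS FILE PROVES (kernel; assembly over tree theorems — nothing new is estimated here).
* `forestDobrushinDoor : StrongCouplingForestGauge.ForestDobrushinDoor` — J-SC19's door BY NAME: rung F2 (forest ∕
  maximal-tree gauge fixing for `SU(N)`, `StrongCouplingForestHolonomyGauge.forestGaugeFixing_specialUnitaryGroup`,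
  leaves 28a/28b) and rung F3 (frozen-forest Dobrushin clustering,
  `StrongCouplingFrozenForestClustering.frozenForestClustering`, leaves 29a–29c), assembled by leaf 27
  (`StrongCouplingForestDoorAssembly`).
* `su2_strongCouplingFront_of_le_twoNinths`, `su2_strongCouplingFront_twoNinths`: the strong-coupling front
  `CrossoverLedger.StrongCouplingFront (fundamentalLatticeRep 2) (β_W/2)` (currency SC-b) on the CLOSED window
  `0 ≤ β_W ≤ 2/9`, endpoint INCLUDED — door × F1-15 (`eventualForestRowBound_fifteen`) × the tree's quarter modulus on
  `β_W ≤ 2/9` (`quarterModulus_of_quarterCovariance quarterCovariance`); `15 · (2/9) · (1/4) = 5/6 < 1`.  (The comb door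
  of `StrongCouplingFluxCovariance.su2_strongCouplingFront` is strict: `β_W < 2/9`.)
* `su2_strongCouplingFront_lt_fourFifteenths_of_quarterModulusUpTo`: below `4/15` the ONE remaining hypothesis is
  rung F4, `QuarterModulusUpTo (4/15)` (proved in the companion leaf `StrongCouplingQuarterModulusFourFifteenths`).

NOT CLAIMED: no number beyond `2/9` is owned BY THIS FILE (the `4/15` statement carries F4 as a hypothesis here);
currencies SC-a (DLR uniqueness) and SC-c (infinite-volume mass gap) are not touched by the forest door; no mass-gap
claim; nothing about the continuum, `N ≥ 3`, or the crossover itself; NOT Bałaban's renormalisation group.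
-/

noncomputable section

open Literature.MathematicalPhysics.QuantumLattice (fundamentalRep fundamentalLatticeRep)
open Literature.MathematicalPhysics.QuantumFieldTheory
open Literature.MathematicalPhysics.QuantumFieldTheory.Balaban1983to89
open Literature.MathematicalPhysics.QuantumFieldTheory.Balaban1983to89.StrongCouplingDobrushinWindow
open Summit.QuantumFields.BalabanUV.InfraRed.StrongCouplingForestGauge
open Summit.QuantumFields.BalabanUV.InfraRed.StrongCouplingStaggerForest
  (eventualForestRowBound_fifteen su2_strongCouplingFront_whatIf15)
open Summit.QuantumFields.BalabanUV.InfraRed.StrongCouplingForestHolonomyGauge (forestDobrushinDoor_of_frozenClustering)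
open Summit.QuantumFields.BalabanUV.InfraRed.StrongCouplingFrozenForestClustering (frozenForestClustering)
open Summit.QuantumFields.BalabanUV.InfraRed.StrongCouplingQuarterCovariance (quarterModulus_of_quarterCovariance)
open Summit.QuantumFields.BalabanUV.InfraRed.StrongCouplingFluxCovariance (quarterCovariance)

namespace Summit.QuantumFields.BalabanUV.InfraRed.StrongCouplingForestDoor

/-- **The forest Dobrushin door is a theorem** (F2 = `forestGaugeFixing_specialUnitaryGroup 2` inside
`forestDobrushinDoor_of_frozenClustering`, F3 = `frozenForestClustering`). [folklore] -/
theorem forestDobrushinDoor : ForestDobrushinDoor :=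
  forestDobrushinDoor_of_frozenClustering frozenForestClustering

/-- **SC-b on the CLOSED window `0 ≤ β_W ≤ 2/9`** through the forest door at row bound `15` and the tree's quarter
modulus on `β_W ≤ 2/9` (`15 · β_W · (1/4) ≤ 5/6 < 1`). [folklore] -/
theorem su2_strongCouplingFront_of_le_twoNinths {b : ℝ} (h0 : 0 ≤ b) (hle : b ≤ 2 / 9) :
    CrossoverLedger.StrongCouplingFront (fundamentalLatticeRep 2) (b / 2) :=
  forestDobrushinDoor 15 b (1 / 4) (by norm_num) h0 eventualForestRowBound_fifteen
    (quarterModulus_of_quarterCovariance quarterCovariance b h0 hle) (by push_cast; linarith)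

/-- Instance: SC-b AT Wilson `β_W = 2/9` (tree bare coupling `1/9`) — the comb door's ceiling, now attained.
[folklore] -/
theorem su2_strongCouplingFront_twoNinths :
    CrossoverLedger.StrongCouplingFront (fundamentalLatticeRep 2) ((2 / 9 : ℝ) / 2) :=
  su2_strongCouplingFront_of_le_twoNinths (by norm_num) le_rfl

/-- **Below `4/15` the one remaining hypothesis is rung F4** (`QuarterModulusUpTo (4/15)`): door × F1-15 × F4.
[folklore] -/
theorem su2_strongCouplingFront_lt_fourFifteenths_of_quarterModulusUpTo (hF4 : QuarterModulusUpTo (4 / 15))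
    {β₀W : ℝ} (h0 : 0 ≤ β₀W) (hlt : β₀W < 4 / 15) :
    CrossoverLedger.StrongCouplingFront (fundamentalLatticeRep 2) (β₀W / 2) :=
  su2_strongCouplingFront_whatIf15 forestDobrushinDoor hF4 h0 hlt

end Summit.QuantumFields.BalabanUV.InfraRed.StrongCouplingForestDoor
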